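import Literature.AlgebraicGeometry.HodgeTheory.SupportedClassesHodgeConiveauProofs
import Literature.AlgebraicGeometry.HodgeTheory.ComplexConjugationHolds
import Literature.NumberTheory.Transcendental.DeRhamTheoremMultiplicative
import HarnessLib

/-!
# Grothendieck's coniveau remark `Nˢ Hᵏ ⊆ ⨆_{a,b ≥ s} H^{a,b}` granted Deligne's Cor. 8.2.8 ALONE

Family `hodge`, layer `Literature/AlgebraicGeometry/HodgeTheory`. Bookkeeping companion of
`SupportedClassesHodgeConiveauProofs`, whose closing theorem
`Grothendieck1969_supportedClasses_le_hodgeConiveau_of_deligne` derives the named fact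
`Grothendieck1969_supportedClasses_le_hodgeConiveau` (A. Grothendieck, Topology 8 (1969), p. 299 (∗)
and p. 300; C. Voisin, *Chow Rings* (2014), Thm. 2.39) from THREE hypotheses: Deligne's *Hodge III*
Cor. 8.2.8 (`Deligne1974_ker_restrictCompl_eq_iSup_range_complexGysin`), the existence of Hodge
models of smooth projective varieties (`nonempty_hodgeModel`) and de Rham's theorem with products
(`exists_deRhamIsoFamily`). The last two are meanwhile THEOREMS of the tree —
`nonempty_hodgeModel_holds` (`ComplexConjugationHolds`: Serre GAGA, de Rham, the Hodge decomposition)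
and `Literature.NumberTheory.Transcendental.exists_deRhamIsoFamily_holds` (`DeRhamTheoremMultiplicative`)
— so the fact, and its consequences for classes of type `(p, q)` with `p < s` or `q < s`, hold
granted Cor. 8.2.8 alone (that file is at its line budget, hence this separate file; its docstring
announces exactly this shape: "`…_holds := …_of_deligne hD_holds hM_holds hdR_holds`").

* `Grothendieck1969_supportedClasses_le_hodgeConiveau_of_deligne'` — `hD → the fact`.
* `eq_zero_of_isOfHodgeType_of_mem_supportedClasses_of_deligne'` — `hD →` a class of type `(p,q)`,
  `p < s ∨ q < s`, supported in codimension `≥ s` is zero.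
* `forall_isOfHodgeType_zero_eq_zero_of_supportedClasses_eq_top` — the "trivial reason" half of the
  generalized Hodge conjecture in coniveau `1` for a full cohomology group: if `N¹ Hᵏ(X(ℂ); ℂ) = Hᵏ`
  then `X` has no non-zero class of type `(k, 0)` (granted the fact), and `…_of_deligne'` (granted
  Cor. 8.2.8). The converse, `h^{k,0} = 0 ⟹ N¹ Hᵏ = Hᵏ`, is Grothendieck's generalized Hodge
  conjecture (Voisin, J. Open Math. Probl. 1 (2025), Conj. 4.6 with `c = 1`), open.

## References

* [GrothendieckTopology1969] A. Grothendieck, Topology 8 (1969) 299–303, p. 299 (∗), p. 300, footnote 13.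
* [DeligneHodgeIII1974] P. Deligne, Théorie de Hodge III, Publ. Math. IHÉS 44 (1974), Cor. 8.2.8.
* [VoisinChowRings2014] C. Voisin, Chow Rings, Decomposition of the Diagonal, and the Topology of
  Families (2014), Def. 2.38, Thm. 2.39.
* [Voisin2025] C. Voisin, J. Open Math. Probl. 1 (2025) 16–51, Conj. 4.6.
-/

noncomputable section

namespace Literature.AlgebraicGeometry.HodgeTheory

section HodgeTheory

open scoped Manifold

variable {n : ℕ} {X : Motives.SchemeOver ℂ}

/-- **Grothendieck's coniveau fact granted Deligne's Cor. 8.2.8 alone**: of the three inputs of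
`Grothendieck1969_supportedClasses_le_hodgeConiveau_of_deligne`, the existence of Hodge models
(`nonempty_hodgeModel_holds`) and de Rham's theorem with products (`exists_deRhamIsoFamily_holds`)
are discharged in the tree. [cite: GrothendieckTopology1969, p. 299 (∗) and p. 300]
[cite: DeligneHodgeIII1974, Cor. 8.2.8] -/
theorem Grothendieck1969_supportedClasses_le_hodgeConiveau_of_deligne'
    (hD : Deligne1974_ker_restrictCompl_eq_iSup_range_complexGysin) :
    Grothendieck1969_supportedClasses_le_hodgeConiveau :=
  Grothendieck1969_supportedClasses_le_hodgeConiveau_of_deligne hD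
    (fun _ _ ↦ nonempty_hodgeModel_holds)
    (fun E _ _ _ ↦ Literature.NumberTheory.Transcendental.exists_deRhamIsoFamily_holds E)

/-- **Granted Cor. 8.2.8 alone: a class of Hodge type `(p, q)` with `p < s` or `q < s` supported in
codimension `≥ s` vanishes** (Voisin II, proof of Thm. 10.31: "`Im τ_* ∩ H^{p,q}(X) = 0`, `q ≤ k₀`").
[cite: GrothendieckTopology1969, p. 300] [cite: DeligneHodgeIII1974, Cor. 8.2.8] -/
theorem eq_zero_of_isOfHodgeType_of_mem_supportedClasses_of_deligne'
    (hD : Deligne1974_ker_restrictCompl_eq_iSup_range_complexGysin)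
    (hX : Motives.IsSmoothProjective n X) {k s p q : ℕ} (hpq : p + q = k) (hs : p < s ∨ q < s)
    {c : complexBetti X k} (hc : c ∈ supportedClasses X k s) (hc' : IsOfHodgeType n X k p q c) :
    c = 0 :=
  (Grothendieck1969_supportedClasses_le_hodgeConiveau_of_deligne' hD).eq_zero_of_isOfHodgeType
    hX hpq hs hc hc'

/-- **The "trivial reason" half of GHC in coniveau `1` for a full cohomology group**: if all of
`Hᵏ(X(ℂ); ℂ)` is supported in codimension `≥ 1` (`supportedClasses X k 1 = ⊤`), then `X` has no
non-zero class of type `(k, 0)` — a holomorphic `k`-form dies on no dense Zariski-open set (granted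
`Grothendieck1969_supportedClasses_le_hodgeConiveau`). The converse `h^{k,0} = 0 ⟹ N¹ Hᵏ = Hᵏ` is
Grothendieck's generalized Hodge conjecture for `L = Hᵏ(X, ℚ)`, `c = 1`, open in general.
[cite: GrothendieckTopology1969, p. 300 and footnote 13] [cite: Voisin2025, Conj. 4.6] -/
theorem forall_isOfHodgeType_zero_eq_zero_of_supportedClasses_eq_top
    (h : Grothendieck1969_supportedClasses_le_hodgeConiveau) (hX : Motives.IsSmoothProjective n X)
    {k : ℕ} (htop : supportedClasses X k 1 = ⊤) :
    ∀ c : complexBetti X k, IsOfHodgeType n X k k 0 c → c = 0 :=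
  fun _ hc ↦ h.eq_zero_of_isOfHodgeType_zero hX le_rfl (htop ▸ Submodule.mem_top) hc

/-- The same granted Deligne's Cor. 8.2.8 alone. [cite: GrothendieckTopology1969, p. 300 and footnote 13]
[cite: DeligneHodgeIII1974, Cor. 8.2.8] -/
theorem forall_isOfHodgeType_zero_eq_zero_of_supportedClasses_eq_top_of_deligne'
    (hD : Deligne1974_ker_restrictCompl_eq_iSup_range_complexGysin)
    (hX : Motives.IsSmoothProjective n X) {k : ℕ} (htop : supportedClasses X k 1 = ⊤) :
    ∀ c : complexBetti X k, IsOfHodgeType n X k k 0 c → c = 0 :=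
  forall_isOfHodgeType_zero_eq_zero_of_supportedClasses_eq_top
    (Grothendieck1969_supportedClasses_le_hodgeConiveau_of_deligne' hD) hX htop

end HodgeTheory

end Literature.AlgebraicGeometry.HodgeTheory

end
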